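import Literature.NumberTheory.Weil1965.ThetaIntegralOrbitFunctionalUnitary
import Literature.NumberTheory.Weil1965.AdelicSiegelFunctionalComplex
import HarnessLib

/-!
# The orbit functional on COMPLEX Schwartz–Bruhat functions: `Λ(Φ) = Λ_ℝ(Re Φ) + i Λ_ℝ(Im Φ)`

Topic `NumberTheory/Weil1965`; namespaces `Literature.NumberTheory.Weil1965` (generic) and
`Literature.NumberTheory.Weil1965.UnitaryDoubling` (the dual pair).  KERNEL MATHEMATICS ONLY: proved theorems, no definition,
no named fact, no `sorry`.  The theta-side twin of ★ `AdelicSiegelFunctionalComplex` §3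
(`tsum_adelicSiegelCoeff_eq_re_add_im : Σ_ξ F*_Φ(ξ) = E_X(Re Φ) + i E_X(Im Φ)`): the Siegel–Weil comparison is run on the REAL
functionals `Λ_θ,ℝ`, `E_X` (positive Radon measures, ★ `AdelicFibreMeasures` ∕ ★ `AdelicFibreMeasuresComparison`) and read
back on complex `Φ ∈ 𝒮(X)` — here `Λ(Φ) = Λ_ℝ(Re Φ) + i · Λ_ℝ(Im Φ)` for the orbit functional
`Λ(Φ) = ∫_{G/Γ} Σ'_{ξ ≠ 0} Φ(A(g) ξ) dν` of ★ `ThetaIntegralOrbitFunctional` (`orbitFunctional_eq_re_add_im`) and for the dual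
pair's `Λ_θ` (`thetaOrbitFunctional_eq_re_add_im`); with ★ `doubledThetaIntegral_eq_measure_mul_apply_zero_add_thetaOrbitFunctional`
this reads `I□ Ψ = κ₀ Ψ♮(0) + Λ_θ,ℝ(Re Ψ♮) + i Λ_θ,ℝ(Im Ψ♮)`.

## References
* [Weil1965] A. Weil, *Sur la formule de Siegel dans la théorie des groupes classiques*, Acta Math. 113 (1965): Chap. IV
  n° 41 p. 59, n° 51–52 pp. 73–75.
-/

set_option autoImplicit false

noncomputable section

namespace Literature.NumberTheory.Weil1965

open Literature.NumberTheory.Automorphic Literature.NumberTheory.Weil1964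
open NumberField _root_.MeasureTheory

section Generic

variable (F : Type) [Field F] [NumberField F] {m : ℕ}
variable {G : Type*} [Group G] [TopologicalSpace G] [IsTopologicalGroup G] [LocallyCompactSpace G]
variable (Γ : Subgroup G) [CompactSpace (G ⧸ Γ)] [MeasurableSpace (G ⧸ Γ)] [BorelSpace (G ⧸ Γ)]
variable (ν : Measure (G ⧸ Γ)) [IsFiniteMeasure ν]
variable (A : G →* ((Fin m → AdeleRing (𝓞 F) F) ≃ₗ[AdeleRing (𝓞 F) F] (Fin m → AdeleRing (𝓞 F) F)))
variable (hA : ∀ x : Fin m → AdeleRing (𝓞 F) F, Continuous fun g => A g x)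
variable (hΓ : ∀ γ ∈ Γ, ∀ ξ : Fin m → F, ∃ ξ' : Fin m → F, A γ (ratPt F (Fin m) ξ) = ratPt F (Fin m) ξ')

omit [NumberField F] in
/-- `Φ = Re Φ + i Im Φ` inside `𝒮(𝔸_F^m)` (★ `re_mem_piSchwartzBruhatReal`, ★ `im_mem_piSchwartzBruhatReal`, ★ `ofRealSB`).
[cite: Weil1965, Chap. IV n° 41, p. 59] -/
theorem eq_ofRealSB_re_add_smul_ofRealSB_im [NumberField F] (Φ : piSchwartzBruhat F (Fin m)) :
    Φ = ofRealSB F ⟨fun v => ((Φ : (Fin m → AdeleRing (𝓞 F) F) → ℂ) v).re, re_mem_piSchwartzBruhatReal Φ.2⟩ +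
      Complex.I • ofRealSB F ⟨fun v => ((Φ : (Fin m → AdeleRing (𝓞 F) F) → ℂ) v).im, im_mem_piSchwartzBruhatReal Φ.2⟩ :=
  Subtype.ext (fun_eq_re_add_im (Φ : (Fin m → AdeleRing (𝓞 F) F) → ℂ))

include hA in
/-- **`Λ(Φ) = Λ_ℝ(Re Φ) + i Λ_ℝ(Im Φ)`** for every `Φ ∈ 𝒮(𝔸_F^m)` (linearity of `Λ` and ★ `orbitFunctional_ofRealSB`).
[cite: Weil1965, Chap. IV n° 41, p. 59; n° 52] -/
theorem orbitFunctional_eq_re_add_im (Φ : piSchwartzBruhat F (Fin m)) :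
    orbitFunctional F Γ ν A hA hΓ Φ =
      (orbitFunctionalReal F Γ ν A hA hΓ
          ⟨fun v => ((Φ : (Fin m → AdeleRing (𝓞 F) F) → ℂ) v).re, re_mem_piSchwartzBruhatReal Φ.2⟩ : ℂ) +
        Complex.I * (orbitFunctionalReal F Γ ν A hA hΓ
          ⟨fun v => ((Φ : (Fin m → AdeleRing (𝓞 F) F) → ℂ) v).im, im_mem_piSchwartzBruhatReal Φ.2⟩ : ℂ) := by
  conv_lhs => rw [eq_ofRealSB_re_add_smul_ofRealSB_im F Φ]
  rw [map_add, map_smul, orbitFunctional_ofRealSB, orbitFunctional_ofRealSB, smul_eq_mul]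

include hA in
/-- **`Λ = κ E` on `𝒮_ℝ` ⇒ `Λ(Φ) = κ (E(Re Φ) + i E(Im Φ))` on `𝒮`** — how an identity of REAL functionals (the output of ★
`linearMap_eq_smul_of_fibreMeasure_eq`) is read on complex test functions. [cite: Weil1965, Chap. IV n° 51, Théorème 5, p. 75] -/
theorem orbitFunctional_eq_of_orbitFunctionalReal_eq_smul (κ : ℝ) (E : piSchwartzBruhatReal F (Fin m) →ₗ[ℝ] ℝ)
    (hE : orbitFunctionalReal F Γ ν A hA hΓ = κ • E) (Φ : piSchwartzBruhat F (Fin m)) :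
    orbitFunctional F Γ ν A hA hΓ Φ =
      (κ : ℂ) * ((E ⟨fun v => ((Φ : (Fin m → AdeleRing (𝓞 F) F) → ℂ) v).re, re_mem_piSchwartzBruhatReal Φ.2⟩ : ℂ) +
        Complex.I * (E ⟨fun v => ((Φ : (Fin m → AdeleRing (𝓞 F) F) → ℂ) v).im, im_mem_piSchwartzBruhatReal Φ.2⟩ : ℂ)) := by
  rw [orbitFunctional_eq_re_add_im, hE, LinearMap.smul_apply, LinearMap.smul_apply, smul_eq_mul, smul_eq_mul,
    Complex.ofReal_mul, Complex.ofReal_mul]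
  ring

end Generic

end Literature.NumberTheory.Weil1965

namespace Literature.NumberTheory.Weil1965.UnitaryDoubling

open _root_.MeasureTheory NumberField
open Literature.NumberTheory.Weil1964 Literature.NumberTheory.Weil1965 Literature.NumberTheory.Automorphic
open Literature.NumberTheory.GelbartRogawski1991 Literature.NumberTheory.GelbartRogawski1991.UnitaryDualPair

section DualPair

variable (F E : Type) [Field F] [NumberField F] [Field E] [NumberField E] [Algebra F E] [Algebra.IsQuadraticExtension F E]
  (c : E ≃ₐ[F] E) {δ : E} (hcδ : c δ = -δ) (hδ : δ ≠ 0) {d : F} (hd : δ * δ = algebraMap F E d)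
  (N : ℕ) {n : ℕ} (e : Fin N × Fin 1 ≃ Fin n)
  (TV : Matrix (Fin N) (Fin N) F) (hV : TV.IsSymm) (hVd : IsUnit TV.det)
  (TW : Matrix (Fin 1) (Fin 1) F) (hW : TW.IsSymm) (hWd : IsUnit TW.det)
  [LocallyCompactSpace (UnitaryGroup.adelic F E c N (TV.map (algebraMap F E)))]
  [CompactSpace (UnitaryGroup.adelic F E c N (TV.map (algebraMap F E)) ⧸ (UnitaryGroup.toAdelic F E c N (TV.map (algebraMap F E))).range)]
  [MeasurableSpace (UnitaryGroup.adelic F E c N (TV.map (algebraMap F E)) ⧸ (UnitaryGroup.toAdelic F E c N (TV.map (algebraMap F E))).range)]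
  [BorelSpace (UnitaryGroup.adelic F E c N (TV.map (algebraMap F E)) ⧸ (UnitaryGroup.toAdelic F E c N (TV.map (algebraMap F E))).range)]
  (ν : Measure (UnitaryGroup.adelic F E c N (TV.map (algebraMap F E)) ⧸ (UnitaryGroup.toAdelic F E c N (TV.map (algebraMap F E))).range)) [IsFiniteMeasure ν]

/-- **`Λ_θ(Φ) = Λ_θ,ℝ(Re Φ) + i Λ_θ,ℝ(Im Φ)`** for the dual pair `(U(J_V), U(J_𝕎))`. [cite: Weil1965, Chap. IV n° 41, p. 59; n° 52] -/
theorem thetaOrbitFunctional_eq_re_add_im (Φ : piSchwartzBruhat F (Fin (n + n))) :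
    thetaOrbitFunctional F E c hcδ hδ hd N e TV hV hVd TW hW hWd ν Φ =
      (thetaOrbitFunctionalReal F E c hcδ hδ hd N e TV hV hVd TW hW hWd ν
          ⟨fun v => ((Φ : (Fin (n + n) → AdeleRing (𝓞 F) F) → ℂ) v).re, re_mem_piSchwartzBruhatReal Φ.2⟩ : ℂ) +
        Complex.I * (thetaOrbitFunctionalReal F E c hcδ hδ hd N e TV hV hVd TW hW hWd ν
          ⟨fun v => ((Φ : (Fin (n + n) → AdeleRing (𝓞 F) F) → ℂ) v).im, im_mem_piSchwartzBruhatReal Φ.2⟩ : ℂ) :=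
  orbitFunctional_eq_re_add_im F (UnitaryGroup.toAdelic F E c N (TV.map (algebraMap F E))).range ν
    (vDiagAct F E c hcδ hδ hd N e TV hV hVd TW hW hWd) (continuous_vDiagAct_apply F E c hcδ hδ hd N e TV hV hVd TW hW hWd)
    (vDiagAct_ratPt_of_mem F E c hcδ hδ hd N e TV hV hVd TW hW hWd) Φ

/-- **`Λ_θ,ℝ = κ E` on `𝒮_ℝ(X□(𝔸))` ⇒ `Λ_θ(Φ) = κ (E(Re Φ) + i E(Im Φ))` on `𝒮(X□(𝔸))`** — with ★
`doubledThetaIntegral_eq_measure_mul_apply_zero_add_thetaOrbitFunctional` and ★ `tsum_adelicSiegelCoeff_eq_re_add_im` this turns the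
measure identity `μ̂_b = κ₀ μ_b (∀ b)` into `I□ Ψ = κ₀ · eis Ψ`. [cite: Weil1965, Chap. IV n° 51, Théorème 5, p. 75] -/
theorem thetaOrbitFunctional_eq_of_thetaOrbitFunctionalReal_eq_smul (κ : ℝ)
    (EX : piSchwartzBruhatReal F (Fin (n + n)) →ₗ[ℝ] ℝ)
    (hE : thetaOrbitFunctionalReal F E c hcδ hδ hd N e TV hV hVd TW hW hWd ν = κ • EX) (Φ : piSchwartzBruhat F (Fin (n + n))) :
    thetaOrbitFunctional F E c hcδ hδ hd N e TV hV hVd TW hW hWd ν Φ =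
      (κ : ℂ) * ((EX ⟨fun v => ((Φ : (Fin (n + n) → AdeleRing (𝓞 F) F) → ℂ) v).re, re_mem_piSchwartzBruhatReal Φ.2⟩ : ℂ) +
        Complex.I * (EX ⟨fun v => ((Φ : (Fin (n + n) → AdeleRing (𝓞 F) F) → ℂ) v).im, im_mem_piSchwartzBruhatReal Φ.2⟩ : ℂ)) :=
  orbitFunctional_eq_of_orbitFunctionalReal_eq_smul F (UnitaryGroup.toAdelic F E c N (TV.map (algebraMap F E))).range ν
    (vDiagAct F E c hcδ hδ hd N e TV hV hVd TW hW hWd) (continuous_vDiagAct_apply F E c hcδ hδ hd N e TV hV hVd TW hW hWd)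
    (vDiagAct_ratPt_of_mem F E c hcδ hδ hd N e TV hV hVd TW hW hWd) κ EX hE Φ

end DualPair

end Literature.NumberTheory.Weil1965.UnitaryDoubling
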